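import Summits.RiemannHypothesis.RiemannHypothesis.Theorems.SoloInformedBlaschke
import Summits.RiemannHypothesis.RiemannHypothesis.Theorems.SoloInformedCompanionPrice

/-!
# T40 — Blaschke pricing of companions: the count hypothesis removed

T39/T39♯ priced each off-line companion of a target zero `ρ₀ = ½ + η + iγ₀` at `Θ(1)` window
units, via Turán's theorem on a sub-interval.  Here the whole configuration is priced AT ONCE by
its Blaschke product at the target.  With `U(τ) = Σ_{ρ ∈ P} m_ρ Φ_J(λ_ρ)² e^{λ_ρ τ}`
(`λ_ρ = ρ - ½ - iγ₀`, `P` = all zeros with `Re ρ > ½`, `|Im ρ - γ₀| < π(J+K)`), ground-state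
positivity `E₀(a) ≥ 0` gives `|U(τ)| ≤ B_J` for all `τ ≤ 2a - 2` (T39g on `[2, 2a-2]`, trivially
below `2`), and the Hardy-space distance inequality (T40a) applied to `u ↦ e^{-σu} U(2a-2-u)`
yields

  `9 e^{2η(2a-2)} |B(ρ₀)|² / (2(η+σ)) ≤ B_J² / (2σ)`,
  `|B(ρ₀)|² = Π_{ρ ∈ P, ρ ≠ ρ₀} ((η - x_ρ)² + y_ρ²) / ((η + x_ρ + 2σ)² + y_ρ²)`

(`x_ρ = Re ρ - ½`, `y_ρ = Im ρ - γ₀`).  NO COUNT, NO POSITION, NO MULTIPLICITY HYPOTHESIS on the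
companions: the configuration enters only through its Blaschke sum
`Σ_ρ ½ log(((3η + x_ρ)² + y_ρ²)/((η - x_ρ)² + y_ρ²))` (σ = η), in which a companion at height
distance `|y_ρ| ≥ 1` costs at most `½ log(1 + 4η/y_ρ²) ≤ 2η / y_ρ²`.
-/

noncomputable section

open Real Complex Set MeasureTheory Finset Literature.NumberTheory.LFunctions
open scoped ComplexConjugate

namespace Summit.RiemannHypothesis.RiemannHypothesis.Theorems

namespace Blaschke

/-- The shifted exponent attached to a zero: `λ_ρ + σ = ρ - ½ - iγ₀ + σ`. -/
def node (γ₀ σ : ℝ) (ρ : ℂ) : ℂ := ρ - 1 / 2 - γ₀ * I + σ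

/-- `node` is injective. -/
theorem node_injective (γ₀ σ : ℝ) : Function.Injective (node γ₀ σ) := by
  intro a b h
  simpa [node] using h

/-- Real part of a node. -/
theorem node_re (γ₀ σ : ℝ) (ρ : ℂ) : (node γ₀ σ ρ).re = ρ.re - 1 / 2 + σ := by
  simp [node]

/-- Imaginary part of a node. -/
theorem node_im (γ₀ σ : ℝ) (ρ : ℂ) : (node γ₀ σ ρ).im = ρ.im - γ₀ := by
  simp [node]

/-- Inverse of `node`. -/
theorem inv_node (γ₀ σ : ℝ) (ρ : ℂ) : node γ₀ σ ρ - σ + 1 / 2 + γ₀ * I = ρ := by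
  unfold node; ring

/-- `node ρ - σ = λ_ρ`. -/
theorem node_sub (γ₀ σ : ℝ) (ρ : ℂ) : node γ₀ σ ρ - σ = ρ - 1 / 2 - γ₀ * I := by
  unfold node; ring

/-- The coefficient carried by the node `l`: `m_ρ Φ_J(λ_ρ)² e^{λ_ρ T}` with `ρ` the zero of `l`. -/
def coeff (J : ℕ) (γ₀ σ T : ℝ) (l : ℂ) : ℂ :=
  ((riemannZetaZeroOrder (l - σ + 1 / 2 + γ₀ * I) : ℝ) : ℂ) *
    (combXform J (l - σ) ^ 2 * cexp ((l - σ) * T))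

/-- The companion sum `U(τ) = Σ_{ρ ∈ P} m_ρ Φ_J(λ_ρ)² e^{λ_ρ τ}`. -/
def compSum (J : ℕ) (γ₀ : ℝ) (P : Finset ℂ) (τ : ℝ) : ℂ :=
  ∑ ρ ∈ P, ((riemannZetaZeroOrder ρ : ℝ) : ℂ) *
    (combXform J (ρ - 1 / 2 - γ₀ * I) ^ 2 * cexp ((ρ - 1 / 2 - γ₀ * I) * τ))

/-- The exponential sum of T40a built on the nodes is `e^{-σu} U(T - u)`. -/
theorem expSum_image_node (J : ℕ) (γ₀ σ T : ℝ) (P : Finset ℂ) (u : ℝ) :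
    expSum (P.image (node γ₀ σ)) (coeff J γ₀ σ T) u =
      cexp (-(σ * u)) * compSum J γ₀ P (T - u) := by
  rw [expSum, Finset.sum_image (fun a _ b _ h ↦ node_injective γ₀ σ h), compSum, Finset.mul_sum]
  refine Finset.sum_congr rfl fun ρ _ ↦ ?_
  rw [coeff, inv_node, node_sub, show node γ₀ σ ρ = (ρ - 1 / 2 - γ₀ * I) + σ from rfl]
  simp only [Complex.ofReal_sub]
  have hexp : cexp ((ρ - 1 / 2 - γ₀ * I) * T) * cexp (-(((ρ - 1 / 2 - γ₀ * I) + σ) * u)) =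
      cexp (-(σ * u)) * cexp ((ρ - 1 / 2 - γ₀ * I) * (T - u)) := by
    rw [← Complex.exp_add, ← Complex.exp_add]
    congr 1
    ring
  linear_combination (((riemannZetaZeroOrder ρ : ℝ) : ℂ) *
    combXform J (ρ - 1 / 2 - γ₀ * I) ^ 2) * hexp

/-- `|U(τ)| ≤ e · S` for `τ ≤ 2`, where `S = Σ m_ρ |Φ_J(λ_ρ)|²`. -/
theorem norm_compSum_le_small (J : ℕ) (γ₀ : ℝ) (P : Finset ℂ)
    (hP : ∀ ρ ∈ P, riemannZeta ρ = 0 ∧ 1 / 2 < ρ.re) {τ : ℝ} (hτ : τ ≤ 2) :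
    ‖compSum J γ₀ P τ‖ ≤ Real.exp 1 *
      ∑ ρ ∈ P, (riemannZetaZeroOrder ρ : ℝ) * ‖combXform J (ρ - 1 / 2 - γ₀ * I)‖ ^ 2 := by
  rw [compSum, Finset.mul_sum]
  refine (norm_sum_le _ _).trans (Finset.sum_le_sum fun ρ hρ ↦ ?_)
  obtain ⟨hz, hre⟩ := hP ρ hρ
  have h1 := re_lt_one_of_riemannZeta_eq_zero hz
  have hm : (0 : ℝ) ≤ riemannZetaZeroOrder ρ := riemannZetaZeroOrder_nonneg_of_zero hz
  have hx : (ρ - 1 / 2 - γ₀ * I).re = ρ.re - 1 / 2 := by simp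
  have hexp : ‖cexp ((ρ - 1 / 2 - γ₀ * I) * τ)‖ ≤ Real.exp 1 := by
    rw [Complex.norm_exp, Real.exp_le_exp]
    have : ((ρ - 1 / 2 - γ₀ * I) * τ).re = (ρ.re - 1 / 2) * τ := by
      rw [Complex.re_mul_ofReal, hx]
    rw [this]
    rcases le_or_gt 0 τ with h0 | h0
    · nlinarith
    · nlinarith
  rw [norm_mul, norm_mul, norm_pow, Complex.norm_real, Real.norm_of_nonneg hm]
  calc (riemannZetaZeroOrder ρ : ℝ) * (‖combXform J (ρ - 1 / 2 - γ₀ * I)‖ ^ 2 *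
        ‖cexp ((ρ - 1 / 2 - γ₀ * I) * τ)‖)
      ≤ (riemannZetaZeroOrder ρ : ℝ) * (‖combXform J (ρ - 1 / 2 - γ₀ * I)‖ ^ 2 *
        Real.exp 1) := by gcongr
    _ = _ := by ring

/-- **`|U(τ)| ≤ B_J` for every `τ ≤ 2a - 2`** under ground-state positivity. -/
theorem norm_compSum_le {J K q : ℕ} (hq : 2 ≤ q) (hK : 1 ≤ K) {a γ₀ : ℝ} (ha : 2 ≤ a)
    (hγ : π * (J + K) ≤ |γ₀|)
    (hK2 : Real.exp a * (2 * combL q / (π * K) ^ (q - 2)) ^ 2 ≤ combC ^ 2) (P : Finset ℂ)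
    (hmem : ∀ ρ, ρ ∈ P ↔ riemannZeta ρ = 0 ∧ 1 / 2 < ρ.re ∧ |ρ.im - γ₀| < π * (J + K))
    (hE : 0 ≤ weilGroundEnergy a) {τ : ℝ} (hτa : τ ≤ 2 * a - 2) :
    ‖compSum J γ₀ P τ‖ ≤
      20 * π * zetaDensityConst * combC ^ 2 * (2 * J + 1) * Real.log (|γ₀| + π * J + 2) := by
  have hP : ∀ ρ ∈ P, riemannZeta ρ = 0 ∧ 1 / 2 < ρ.re ∧ |ρ.im - γ₀| < π * (J + K) :=
    fun ρ hρ ↦ (hmem ρ).mp hρ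
  rcases le_or_gt 2 τ with h2 | h2
  · exact norm_combExpSum_le hq hK ha hγ hK2 P hP (Companion.zone_complete hγ hmem) hE h2 hτa
  · have hP' : ∀ ρ ∈ P, riemannZeta ρ = 0 ∧ 0 ≤ ρ.re ∧ ρ.re ≤ 1 ∧ ρ.im ≠ 0 := by
      intro ρ hρ
      obtain ⟨hz, hre, him⟩ := hP ρ hρ
      refine ⟨hz, by linarith, (re_lt_one_of_riemannZeta_eq_zero hz).le, ?_⟩
      intro h0
      rw [h0, zero_sub, abs_neg] at him
      linarith
    have hS := sum_norm_sq_combXform_le γ₀ J P hP'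
    have he : Real.exp 1 ≤ 5 := by
      have := Real.exp_one_lt_d9; norm_num at this; linarith
    have hL : 0 ≤ 4 * π * zetaDensityConst * combC ^ 2 * (2 * J + 1) *
        Real.log (|γ₀| + π * J + 2) := by
      have : (1 : ℝ) ≤ |γ₀| + π * J + 2 := by
        have := abs_nonneg γ₀; have : (0:ℝ) ≤ π * J := by positivity
        linarith
      have := Real.log_nonneg this
      have := zetaDensityConst_pos.le
      have := combC_nonneg
      positivity
    calc ‖compSum J γ₀ P τ‖
        ≤ Real.exp 1 * ∑ ρ ∈ P, (riemannZetaZeroOrder ρ : ℝ) *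
            ‖combXform J (ρ - 1 / 2 - γ₀ * I)‖ ^ 2 :=
          norm_compSum_le_small J γ₀ P (fun ρ hρ ↦ ⟨(hP ρ hρ).1, (hP ρ hρ).2.1⟩) h2.le
      _ ≤ 5 * (4 * π * zetaDensityConst * combC ^ 2 * (2 * J + 1) *
            Real.log (|γ₀| + π * J + 2)) :=
          mul_le_mul he hS (Finset.sum_nonneg fun ρ hρ ↦ mul_nonneg
              (riemannZetaZeroOrder_nonneg_of_zero (hP ρ hρ).1) (sq_nonneg _)) (by norm_num)
      _ = _ := by ring

/-- **T40 (Blaschke pricing).**  Under `E₀(a) ≥ 0`, for the target `ρ₀ = ½ + η + iγ₀ ∈ P`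
(`P` = the zeros with `Re ρ > ½`, `|Im ρ - γ₀| < π(J+K)`) and any `σ > 0`:
`9 e^{2η(2a-2)} |B(ρ₀)|² / (2(η + σ)) ≤ B_J² / (2σ)`, `B` the Blaschke product of the
shifted exponents `λ_ρ + σ` of the companions, evaluated at `η + σ`. -/
theorem blaschke_window {η : ℝ} (hη : 0 < η) {J K q : ℕ} (hq : 2 ≤ q) (hK : 1 ≤ K)
    (hKJ : K ≤ J) {a γ₀ σ : ℝ} (ha : 2 ≤ a) (hσ : 0 < σ) (hγ : π * (J + K) ≤ |γ₀|)
    (hK2 : Real.exp a * (2 * combL q / (π * K) ^ (q - 2)) ^ 2 ≤ combC ^ 2)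
    (hε : 2 * combL q / (π ^ q * K ^ (q - 1)) ≤ 1 / 4) (P : Finset ℂ)
    (hmem : ∀ ρ, ρ ∈ P ↔ riemannZeta ρ = 0 ∧ 1 / 2 < ρ.re ∧ |ρ.im - γ₀| < π * (J + K))
    (hE : 0 ≤ weilGroundEnergy a) (hζ : riemannZeta (1 / 2 + η + γ₀ * I) = 0) :
    9 * Real.exp (2 * η * (2 * a - 2)) *
        ‖blaschke ((P.erase (1 / 2 + η + γ₀ * I)).image (node γ₀ σ)) ((η + σ : ℝ) : ℂ)‖ ^ 2 /
          (2 * (η + σ)) ≤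
      (20 * π * zetaDensityConst * combC ^ 2 * (2 * J + 1) *
        Real.log (|γ₀| + π * J + 2)) ^ 2 / (2 * σ) := by
  classical
  set ρ₀ : ℂ := 1 / 2 + η + γ₀ * I with hρ₀
  set B : ℝ := 20 * π * zetaDensityConst * combC ^ 2 * (2 * J + 1) *
    Real.log (|γ₀| + π * J + 2) with hB
  set T : ℝ := 2 * a - 2 with hT
  have hP : ∀ ρ ∈ P, riemannZeta ρ = 0 ∧ 1 / 2 < ρ.re ∧ |ρ.im - γ₀| < π * (J + K) :=
    fun ρ hρ ↦ (hmem ρ).mp hρ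
  have hKr : (1 : ℝ) ≤ K := by exact_mod_cast hK
  have hρ₀re : ρ₀.re = 1 / 2 + η := by simp [hρ₀]
  have hρ₀im : ρ₀.im = γ₀ := by simp [hρ₀]
  have hρ₀P : ρ₀ ∈ P := by
    rw [hmem]; refine ⟨hζ, by rw [hρ₀re]; linarith, ?_⟩
    rw [hρ₀im, sub_self, abs_zero]; positivity
  have hη1 : η < 1 / 2 := by
    have := re_lt_one_of_riemannZeta_eq_zero hζ; rw [hρ₀re] at this; linarith
  -- the node configuration
  set Λ : Finset ℂ := (P.erase ρ₀).image (node γ₀ σ) with hΛ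
  have hl₀ : node γ₀ σ ρ₀ = ((η + σ : ℝ) : ℂ) := by
    simp only [node, hρ₀]; push_cast; ring
  have hl₀Λ : ((η + σ : ℝ) : ℂ) ∉ Λ := by
    rw [← hl₀, hΛ, Finset.mem_image]
    rintro ⟨ρ, hρ, h⟩
    exact (Finset.mem_erase.mp hρ).1 (node_injective γ₀ σ h)
  have hins : insert (((η + σ : ℝ) : ℂ)) Λ = P.image (node γ₀ σ) := by
    rw [← hl₀, hΛ, ← Finset.image_insert, Finset.insert_erase hρ₀P]
  have hpos : ∀ l ∈ insert (((η + σ : ℝ) : ℂ)) Λ, 0 < l.re := by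
    rw [hins]
    intro l hl
    obtain ⟨ρ, hρ, rfl⟩ := Finset.mem_image.mp hl
    rw [node_re]
    linarith [(hP ρ hρ).2.1]
  -- the sup bound
  have hbound : ∀ u : ℝ, 0 < u →
      ‖expSum (insert (((η + σ : ℝ) : ℂ)) Λ) (coeff J γ₀ σ T) u‖ ≤ B * Real.exp (-σ * u) := by
    intro u hu
    have hre : (-((σ : ℂ) * u)).re = -σ * u := by
      simp [Complex.mul_re]
    rw [hins, expSum_image_node, norm_mul, Complex.norm_exp, hre]
    calc Real.exp (-σ * u) * ‖compSum J γ₀ P (T - u)‖ ≤ Real.exp (-σ * u) * B := by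
          gcongr
          exact norm_compSum_le hq hK ha hγ hK2 P hmem hE (by linarith)
      _ = B * Real.exp (-σ * u) := mul_comm _ _
  have key := blaschke_lower_bound Λ hl₀Λ hpos (coeff J γ₀ σ T) hσ hbound
  -- the leading coefficient
  have hre0 : (((η + σ : ℝ) : ℂ)).re = η + σ := Complex.ofReal_re _
  rw [hre0] at key
  have hm1 : (1 : ℝ) ≤ riemannZetaZeroOrder ρ₀ := by
    have := (riemannZetaZeroOrder_pos_iff (ne_one_of_riemannZeta_eq_zero hζ)).mpr hζ
    exact_mod_cast this
  have hflat : ‖combXform J η - 2‖ ≤ 2 * combL q / (π ^ q * K ^ (q - 1)) := by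
    refine norm_combXform_sub_two_le hq hK hKJ ?_ ?_
    · rw [Complex.ofReal_re, abs_le]; constructor <;> linarith
    · rw [Complex.ofReal_im, abs_zero]
      have : (K : ℝ) ≤ J := by exact_mod_cast hKJ
      exact mul_nonneg Real.pi_pos.le (by linarith)
  have h3 := (Companion.flat_multiplier hflat hε).2.1
  have hcoef : 3 * Real.exp (η * T) ≤ ‖coeff J γ₀ σ T ((η + σ : ℝ) : ℂ)‖ := by
    rw [← hl₀, coeff, inv_node, node_sub]
    have hlam : ρ₀ - 1 / 2 - γ₀ * I = (η : ℂ) := by rw [hρ₀]; ring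
    rw [hlam, norm_mul, norm_mul, norm_pow, Complex.norm_real, Complex.norm_exp,
      Complex.re_ofReal_mul, Complex.ofReal_re, Real.norm_of_nonneg (by linarith)]
    have hexp := Real.exp_pos (η * T)
    have h13 : 1 * 3 ≤ (riemannZetaZeroOrder ρ₀ : ℝ) * ‖combXform J η‖ ^ 2 :=
      mul_le_mul hm1 h3 (by norm_num) (by linarith)
    nlinarith
  -- combine
  have h9 : 9 * Real.exp (2 * η * T) ≤ ‖coeff J γ₀ σ T ((η + σ : ℝ) : ℂ)‖ ^ 2 := by
    have h := pow_le_pow_left₀ (by positivity) hcoef 2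
    have he : Real.exp (2 * η * T) = Real.exp (η * T) ^ 2 := by
      rw [← Real.exp_nat_mul]; ring_nf
    rw [he]
    nlinarith [h]
  have hησ : 0 < 2 * (η + σ) := by positivity
  calc 9 * Real.exp (2 * η * T) * ‖blaschke Λ ((η + σ : ℝ) : ℂ)‖ ^ 2 / (2 * (η + σ))
      ≤ ‖coeff J γ₀ σ T ((η + σ : ℝ) : ℂ)‖ ^ 2 * ‖blaschke Λ ((η + σ : ℝ) : ℂ)‖ ^ 2 /
          (2 * (η + σ)) := by gcongr
    _ ≤ B ^ 2 / (2 * σ) := key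

/-- The Blaschke factor of one companion, written in the coordinates `x = Re ρ - ½`,
`y = Im ρ - γ₀`. -/
theorem norm_sq_blaschke_factor (η σ γ₀ : ℝ) (ρ : ℂ) :
    ‖(((η + σ : ℝ) : ℂ) - node γ₀ σ ρ) / (((η + σ : ℝ) : ℂ) + conj (node γ₀ σ ρ))‖ ^ 2 =
      ((η - (ρ.re - 1 / 2)) ^ 2 + (ρ.im - γ₀) ^ 2) /
        ((η + (ρ.re - 1 / 2) + 2 * σ) ^ 2 + (ρ.im - γ₀) ^ 2) := by
  have hnum : ((η + σ : ℝ) : ℂ) - node γ₀ σ ρ =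
      ((η - (ρ.re - 1 / 2) : ℝ) : ℂ) + ((-(ρ.im - γ₀) : ℝ) : ℂ) * I := by
    apply Complex.ext
    · simp [node]
    · simp [node]
  have hden : ((η + σ : ℝ) : ℂ) + conj (node γ₀ σ ρ) =
      ((η + (ρ.re - 1 / 2) + 2 * σ : ℝ) : ℂ) + ((-(ρ.im - γ₀) : ℝ) : ℂ) * I := by
    apply Complex.ext
    · simp [node]; ring
    · simp [node]; ring
  rw [norm_div, div_pow, hnum, hden, Complex.norm_add_mul_I, Complex.norm_add_mul_I,
    Real.sq_sqrt (by positivity), Real.sq_sqrt (by positivity)]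
  ring

/-- `|B(ρ₀)|²` as a product over the companions. -/
theorem norm_sq_blaschke_eq_prod (η σ γ₀ : ℝ) (Q : Finset ℂ) :
    ‖blaschke (Q.image (node γ₀ σ)) ((η + σ : ℝ) : ℂ)‖ ^ 2 =
      ∏ ρ ∈ Q, ((η - (ρ.re - 1 / 2)) ^ 2 + (ρ.im - γ₀) ^ 2) /
        ((η + (ρ.re - 1 / 2) + 2 * σ) ^ 2 + (ρ.im - γ₀) ^ 2) := by
  rw [blaschke, Finset.prod_image (fun a _ b _ h ↦ node_injective γ₀ σ h), norm_prod,
    ← Finset.prod_pow]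
  exact Finset.prod_congr rfl fun ρ _ ↦ norm_sq_blaschke_factor η σ γ₀ ρ

end Blaschke

open Blaschke in
/-- **T40, logarithmic form (σ = η).**  Under `E₀(a) ≥ 0`, a zero `½ + η + iγ₀` forces
`η(2a-2) ≤ log B_J + ½ Σ_{ρ ∈ P, ρ ≠ ρ₀} log(((3η + x_ρ)² + y_ρ²)/((η - x_ρ)² + y_ρ²))`:
the window inequality with the count hypothesis of T39 replaced by the Blaschke sum of the
actual configuration — every companion priced individually and logarithmically, none at more
than `log((3η + ½)/|η - x_ρ|)` unless it sits at the target's offset, far ones at `≤ 2η/y_ρ²`. -/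
theorem blaschke_window_log {η : ℝ} (hη : 0 < η) {J K q : ℕ} (hq : 2 ≤ q) (hK : 1 ≤ K)
    (hKJ : K ≤ J) {a γ₀ : ℝ} (ha : 2 ≤ a) (hγ : π * (J + K) ≤ |γ₀|)
    (hK2 : Real.exp a * (2 * combL q / (π * K) ^ (q - 2)) ^ 2 ≤ combC ^ 2)
    (hε : 2 * combL q / (π ^ q * K ^ (q - 1)) ≤ 1 / 4) (P : Finset ℂ)
    (hmem : ∀ ρ, ρ ∈ P ↔ riemannZeta ρ = 0 ∧ 1 / 2 < ρ.re ∧ |ρ.im - γ₀| < π * (J + K))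
    (hE : 0 ≤ weilGroundEnergy a) (hζ : riemannZeta (1 / 2 + η + γ₀ * I) = 0) :
    η * (2 * a - 2) ≤
      Real.log (20 * π * zetaDensityConst * combC ^ 2 * (2 * J + 1) *
          Real.log (|γ₀| + π * J + 2)) +
        (∑ ρ ∈ P.erase (1 / 2 + η + γ₀ * I),
          Real.log (((3 * η + (ρ.re - 1 / 2)) ^ 2 + (ρ.im - γ₀) ^ 2) /
            ((η - (ρ.re - 1 / 2)) ^ 2 + (ρ.im - γ₀) ^ 2))) / 2 := by
  classical
  have hP : ∀ ρ ∈ P, riemannZeta ρ = 0 ∧ 1 / 2 < ρ.re ∧ |ρ.im - γ₀| < π * (J + K) :=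
    fun ρ hρ ↦ (hmem ρ).mp hρ
  have key := blaschke_window hη hq hK hKJ ha hη hγ hK2 hε P hmem hE hζ
  set B : ℝ := 20 * π * zetaDensityConst * combC ^ 2 * (2 * J + 1) *
    Real.log (|γ₀| + π * J + 2) with hB
  set Q := P.erase (1 / 2 + η + γ₀ * I) with hQ
  have hQre : ∀ ρ ∈ Q, 1 / 2 < ρ.re := fun ρ hρ ↦ (hP ρ (Finset.mem_of_mem_erase hρ)).2.1
  have e3 : ∀ ρ : ℂ, η + (ρ.re - 1 / 2) + 2 * η = 3 * η + (ρ.re - 1 / 2) := fun ρ ↦ by ring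
  rw [norm_sq_blaschke_eq_prod] at key
  simp only [e3] at key
  -- each factor is positive
  have hnum : ∀ ρ ∈ Q, 0 < (η - (ρ.re - 1 / 2)) ^ 2 + (ρ.im - γ₀) ^ 2 := by
    intro ρ hρ
    rcases (add_nonneg (sq_nonneg (η - (ρ.re - 1 / 2))) (sq_nonneg (ρ.im - γ₀))).eq_or_lt
      with h0 | h0
    · exfalso
      have h1 : (η - (ρ.re - 1 / 2)) ^ 2 = 0 := by
        linarith [sq_nonneg (η - (ρ.re - 1 / 2)), sq_nonneg (ρ.im - γ₀)]
      have h2 : (ρ.im - γ₀) ^ 2 = 0 := by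
        linarith [sq_nonneg (η - (ρ.re - 1 / 2)), sq_nonneg (ρ.im - γ₀)]
      rw [pow_eq_zero_iff two_ne_zero] at h1 h2
      refine (Finset.mem_erase.mp hρ).1 (Complex.ext ?_ ?_)
      · simp; linarith
      · simp; linarith
    · exact h0
  have hden : ∀ ρ ∈ Q, 0 < (3 * η + (ρ.re - 1 / 2)) ^ 2 + (ρ.im - γ₀) ^ 2 := by
    intro ρ hρ
    have h1 : 0 < 3 * η + (ρ.re - 1 / 2) := by linarith [hQre ρ hρ]
    exact add_pos_of_pos_of_nonneg (pow_pos h1 2) (sq_nonneg _)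
  have hfac : ∀ ρ ∈ Q, 0 < ((η - (ρ.re - 1 / 2)) ^ 2 + (ρ.im - γ₀) ^ 2) /
      ((3 * η + (ρ.re - 1 / 2)) ^ 2 + (ρ.im - γ₀) ^ 2) :=
    fun ρ hρ ↦ div_pos (hnum ρ hρ) (hden ρ hρ)
  set Pr : ℝ := ∏ ρ ∈ Q, ((η - (ρ.re - 1 / 2)) ^ 2 + (ρ.im - γ₀) ^ 2) /
      ((3 * η + (ρ.re - 1 / 2)) ^ 2 + (ρ.im - γ₀) ^ 2) with hPr
  have hPrpos : 0 < Pr := Finset.prod_pos hfac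
  -- clear denominators: 9 e^{2η(2a-2)} Pr ≤ 2 B²
  have h4 : (0 : ℝ) < 2 * (η + η) := by positivity
  rw [div_le_iff₀ h4] at key
  have hclear : B ^ 2 / (2 * η) * (2 * (η + η)) = 2 * B ^ 2 := by
    field_simp; ring
  rw [hclear] at key
  -- `B > 0`
  have hBnn : 0 ≤ B := by
    have h1 : (1 : ℝ) ≤ |γ₀| + π * J + 2 := by
      have := abs_nonneg γ₀
      have : (0 : ℝ) ≤ π * J := by positivity
      linarith
    have := Real.log_nonneg h1
    have := zetaDensityConst_pos.le
    rw [hB]; positivity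
  have hB0 : 0 < B := by
    rcases hBnn.eq_or_lt with h | h
    · exfalso
      rw [← h] at key
      have : 0 < 9 * Real.exp (2 * η * (2 * a - 2)) * Pr := by positivity
      norm_num at key
      linarith
    · exact h
  -- logarithms
  have hlog := Real.log_le_log (by positivity) key
  rw [Real.log_mul (by positivity) hPrpos.ne', Real.log_mul (by norm_num) (Real.exp_pos _).ne',
    Real.log_exp, Real.log_mul (by norm_num) (by positivity), Real.log_pow] at hlog
  push_cast at hlog
  have h92 : Real.log 2 ≤ Real.log 9 := Real.log_le_log (by norm_num) (by norm_num)
  have hsum : ∑ ρ ∈ Q, Real.log (((3 * η + (ρ.re - 1 / 2)) ^ 2 + (ρ.im - γ₀) ^ 2) /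
      ((η - (ρ.re - 1 / 2)) ^ 2 + (ρ.im - γ₀) ^ 2)) = -Real.log Pr := by
    rw [hPr, Real.log_prod (fun ρ hρ ↦ (hfac ρ hρ).ne'), ← Finset.sum_neg_distrib]
    refine Finset.sum_congr rfl fun ρ hρ ↦ ?_
    rw [Real.log_div (hden ρ hρ).ne' (hnum ρ hρ).ne', Real.log_div (hnum ρ hρ).ne' (hden ρ hρ).ne']
    ring
  linarith [hlog, h92, hsum]

end Summit.RiemannHypothesis.RiemannHypothesis.Theorems
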